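import Summits.QuantumFields.YangMills.Theorems.BalabanUVNodesN15PerCubeGreenFineRows
import Summits.QuantumFields.YangMills.Theorems.BalabanUVNodesN15TwoSpacingGluingCurvedKnitCovariantLandau
import Summits.QuantumFields.YangMills.Theorems.BalabanUVNodesN15CovariantLandauCovariance
import Summits.QuantumFields.YangMills.Theorems.BalabanUVNodesN15CovariantAveragingTransportSizes
import Summits.QuantumFields.YangMills.Theorems.BalabanUVNodesN15CovariantLandauNeumannRows
import Summits.QuantumFields.YangMills.Theorems.BalabanUVNodesN15PerCubeGreenSummand
import HarnessLib

/-!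
# FINE-GRID TWIN n15-c∕264′ of n15-c∕264 at spacing `L^{−r}L^{−k}`: the SAME statements and proofs on the fine site carrier `ScX' = Tor (fine (L^r·L^k) (cvM))` of n15-c∕260′
# (primed objects `scShift' scChi' scPsi' scQQ' scCube' scGlued' scP' scNV' …`, extra argument `r ≥ 1`, mass `a_K(a₀,L,r+k)·(L^rL^k)^{d+1}`, flat rows Ξ-4 r5∕r6∕r8); prepared for the
# two-grid η-defect (PC-E). Textual twin of the coarse file (token priming + `L^k ↦ L^r·L^k`); carrier-generic lemmas are IMPORTED from the coarse files, carrier-specific ones are primed.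
#
# N15 = NE2, road (c) — PROGRAMME (PC), FILE E: BAŁABAN's COVARIANT AVERAGING SUMMAND `P := a·Q′_Tᵀ Q′_T` LIVE IN THE SCALAR KNIT — its conjugation law in the per-cube
# gauges is DEFINITIONAL (`N_V k := a·Q′₁ᵀQ′₁ − W_k P W_kᵀ = a·(Q′₁ᵀQ′₁ − Q′_{T_k}ᵀQ′_{T_k})`, `T_k` = the transporters of `U^{w_k}`), its far row VANISHES (block-diagonal), and its
# cut row is a BOX-LOCAL staircase letter: `M_{ψ_k}N_V kM_{χ_k} ≤ |a|n^{−(d+1)}·|ι|(|ι|σ² + 2σ)`, `σ = (1 + r_V n⁻¹)^{(d+1)n} − 1`, from the (3.35) row letters of `U^{w_k}` ON THE BOX ONLY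
# (dag-n15-c g26, n15-c∕264′)

Cell `pub-ymgap`, seat `pub-ymgap-dag-n15-c` (generation g26; R134 (a), s1; HUMAN RULING D-0062; chair R424 venue).  `bears_on: R4∕N15 · K3⁸ SpineGivenEndpointR13SepCoPHV
(stmt-QuantumFields-27366)`; filed `--supports stmt-QuantumFields-27366 --as helper` — COUNT-NEUTRAL.  Plumbing `def`s (`scGaugeU'`, `scP'`, `scNV'`) + theorems; 0 `sorry`.  Imports BY
NAME n15-c∕261′ `…PerCubeGreenFineRows` (objects + generic cut lemmas), n15-c∕264 `…PerCubeGreenSummand` (`abs_sum_one_sub_mul_le`), n15-c∕201 `…TwoSpacingGluingCurvedKnitCovariantLandau` (`cvT`, `mmulOp_eq_mulVecLin_bdiag`, dag-n15-w2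
`uN_siteGauge_transpose_eq`, `coordMat_mulLeftRight_mul`), n15-c∕198 `…CovariantLandauCovariance` (`gaugeT`, `csavg_gauge`, `bdiag_orth`, `bdiag_transpose`), n15-c∕182
`…CovariantAveragingTransportSizes` (`rows_mprod_sub_one_le`); through them n15-c∕250 `csavg_transpose_mul_csavg_apply`.  Nothing in the tree is modified.

WHY.  FILES C∕D leave 52's summand rows displayed: the conjugation law `hP`, the cut row `hNVcut` and the far row `hfarN` of `N_V`.  For Bałaban's averaging summand of
`Δ′_a(U) = D*_UD_U + aQ′*_UQ′_U` ([Balaban1985BackgroundPropagators] (3.24) p.394) — `P := a·Q′_Tᵀ Q′_T` with `T = cvT e U` — all three are THEOREMS with NO global smallness: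
`Q′_T` reads `T` only along staircases INSIDE one block ((3.19) p.393), so `N_V k` is block-diagonal and its size on the cut box is controlled by the (3.35) letters of the gauged field
`U^{w_k}` on that box alone — exactly the locality the print uses on p.410 («a term … depends on U restricted to □̃₀ ∪ … ∪ □̃ₙ»).
* §1 objects: `scGaugeU' w U` (`U^{w}_μ(x) = w(x)U_μ(x)w(x+e_μ)ᴴ`), ★ `scP' a e U := mulVecLin (a·(Q′_{T_U})ᵀQ′_{T_U})`, ★ `scNV' a e w U k := a·Q′₁ᵀQ′₁ ⊗ 1 − M_{W_k}∘scP'∘M_{W_kᵀ}`; `scP'_conj` [hP,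
  definitional]; `cvT_scGaugeU'` (the gauged transporters are `gaugeT W T`), ★ `scP'_gauge` (`M_W scP'(U) M_{Wᵀ} = scP'(U^w)`: n15-c∕198 `csavg_gauge` + `bdiag_orth`), ★ `scNV'_eq`
  (`N_V k = mulVecLin (a·(Q′₁ᵀQ′₁ − Q′_{T_k}ᵀQ′_{T_k}))`).
* §2 block-diagonality: `csavgSq_sub_apply_of_ne'` (entries vanish across blocks), ★★ `one_sub_scPsi'_comp_scNV'_comp_scChi'` [hfarN]: `(1 − M_{ψ_k})∘N_V k∘M_{χ_k} = 0`.
* §3 the box-local letter: ★ `rows_cvaStair_sub_one_le_of_blockOf'` (the staircase of block `y` reads bonds of block `y` only), `abs_csavgSq_sub_entry_le` (entries of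
  `Q′₁ᵀQ′₁ − Q′_TᵀQ′_T` from staircase ENTRY letters `σ`: `≤ n^{−2(d+1)}(|ι|σ² + 2σ)`), ★★★ `hasMaj_csavgSq_sub_cut'` (the block row `≤ |a|n^{−(d+1)}|ι|(|ι|σ² + 2σ)` given the letters
  on the blocks of `supp χ`), ★★★ `hasMaj_scNV'_cut_of_rows` [hNVcut] from the ROW letters `Σ_j|(T_k μ x − 1)_{ij}| ≤ r_V n⁻¹` of the gauged transporters at the sites under the cut.

HONEST FRAMING ∕ LIMITS.  Finite-dimensional algebra and bookkeeping on MODEL carriers (doubled-cube torus cover; `U(m)`-valued site bond fields in trace-form coordinates; unit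
weights; crude constants `|ι|(|ι|σ² + 2σ)`); [B9] (3.19) p.393, (3.24) p.394, (3.28)–(3.35) pp.395–396, p.410 = SHAPES ∕ MECHANISM, nothing of [B5]∕[B6]∕[B9] asserted.  NE2⁺ NOT
PRINTED, NOT proved; N15 of record untouched (DISCHARGED AS CONSUMED, p687738); K3⁸ OPEN; counts of record UNMOVED (typed 28∕28 · discharged 8∕27); one finite 𝕋⁴ at fixed ε per
index — NOT infinite volume, NOT OS on ℝ⁴, NOT a mass gap, NOT Clay.  Restate-immune (no Theses import).
-/

noncomputable section

open scoped BigOperators Matrix Matrix.Norms.L2Operator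

namespace Summit.QuantumFields.YangMills.BalabanUVNodes.N15.Gluing

open Real
open Literature.MathematicalPhysics.QuantumFieldTheory.Balaban1983to89
open Literature.MathematicalPhysics.QuantumFieldTheory.Balaban1983to89.B5Prop11Plancherel (Tor fine unitVec)
open Literature.MathematicalPhysics.QuantumFieldTheory.Balaban1983to89.B11SectG (BlockNorm HasMaj)
open Literature.MathematicalPhysics.QuantumFieldTheory.Balaban1983to89.B6Prop26Gluing (mulOp mulOp_apply ind ind_nonneg)
open Literature.MathematicalPhysics.QuantumFieldTheory.Balaban1983to89.B6UnitTorusCarrier (unitTorusGeo)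
open Literature.MathematicalPhysics.QuantumFieldTheory.Balaban1983to89.B11AxialTransport190 (abs_le_loc_ofBlocks loc_ofBlocks_le)
open Literature.MathematicalPhysics.QuantumFieldTheory.King1986.Torus (blockOf tdistT tdistT_nonneg tdistT_self)
open Literature.Barriers.QuantumFields (traceForm)
open Summit.QuantumFields.YangMills.BalabanUVNodes.N15.BackgroundLayer (tCoefA tCoefA_inl)
open Literature.MathematicalPhysics.QuantumFieldTheory.Balaban1983to89.B5Block118 (bpt)
open Summit.QuantumFields.YangMills.BalabanUVNodes.N15.VectorPiece (blockCoords)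
open Summit.QuantumFields.YangMills.BalabanUVNodes.N15.MatrixSpecies (mmulOp mmulOp_apply coordMat liftBlk)
open Summit.QuantumFields.YangMills.BalabanUVNodes.N15.TwoGrid (chiCube cubeBlocks chiCube_of_not_mem abs_chiCube_le_one)
open Summit.QuantumFields.YangMills.BalabanUVNodes.N15.CurvedSpecies (gaugePair gaugePair_inl uN_siteGauge_transpose_eq uN_coordMat_conj_orthogonal coordMat_mulLeftRight_mul)
open Summit.QuantumFields.YangMills.BalabanUVNodes.N15.CovLandau (csavg gaugeT csavg_gauge bdiag bdiag_orth bdiag_transpose csavg_transpose_mul_csavg_apply card_fibre_blockOf_fine mulVecLin_sub')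
open Summit.QuantumFields.YangMills.BalabanUVNodes.N15.CovAvg (cvaStair cvaStair_one cvaLeg mprod rows_mprod_sub_one_le)
open Summit.QuantumFields.YangMills.BalabanUVNodes.N15.DefectKernel (kingBlockOf_bpt)

variable {d : ℕ}

/-! ## §1 The covariant averaging summand, its gauged forms, the perturbations `N_V k` -/

section Objects

variable (d) (L : ℕ) [NeZero L] {mm : Type} [Fintype mm] [DecidableEq mm]

/-- the GAUGED SITE BOND FIELD `U^{w}_μ(x) = w(x)·U_μ(x)·w(x + e_μ)ᴴ`. [cite: Balaban1985BackgroundPropagators, (3.28) p.395 (shape)] -/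
def scGaugeU' (mv kk r : ℕ) (hL : Odd L ∧ 1 < L) (w : ScX' d L mv kk r hL → Matrix mm mm ℂ) (U : Fin (d + 1) → ScX' d L mv kk r hL → Matrix mm mm ℂ) :
    Fin (d + 1) → ScX' d L mv kk r hL → Matrix mm mm ℂ :=
  fun μ x => w x * U μ x * (w (scShift' d L mv kk r hL μ x))ᴴ

/-- ★ **BAŁABAN's COVARIANT AVERAGING SUMMAND** `P := a·Q′_Tᵀ Q′_T` of `Δ′_a(U)` at the transporters `T = cvT e U` (n15-c∕197 `csavg`). [cite: Balaban1985BackgroundPropagators, (3.24) p.394 (shape)] -/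
def scP' (mv kk r : ℕ) (hL : Odd L ∧ 1 < L) (a : ℝ) (ι : Type) [Fintype ι] [DecidableEq ι] (e : Matrix mm mm ℂ ≃L[ℝ] (ι → ℝ)) (U : Fin (d + 1) → ScX' d L mv kk r hL → Matrix mm mm ℂ) :
    (ScX' d L mv kk r hL × ι → ℝ) →ₗ[ℝ] (ScX' d L mv kk r hL × ι → ℝ) :=
  Matrix.mulVecLin (a • ((csavg (cvM d L mv kk hL) (L ^ r * L ^ kk) (cvT e U))ᵀ * csavg (cvM d L mv kk hL) (L ^ r * L ^ kk) (cvT e U)))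

/-- ★ THE PERTURBATIONS `N_V k := a·Q′₁ᵀQ′₁ ⊗ 1 − M_{W_k}∘P∘M_{W_kᵀ}` (`W_k = coordMat e Ad_{w_k}`): 52's conjugation law `hP` holds BY DEFINITION. [cite: Balaban1985BackgroundPropagators, (3.59)–(3.60) p.402 (shape)] -/
def scNV' (mv kk r : ℕ) (hL : Odd L ∧ 1 < L) (a : ℝ) (ι : Type) [Fintype ι] [DecidableEq ι] (e : Matrix mm mm ℂ ≃L[ℝ] (ι → ℝ))
    (w : (Fin (d + 1) → ZMod (2 * L)) → ScX' d L mv kk r hL → Matrix mm mm ℂ) (U : Fin (d + 1) → ScX' d L mv kk r hL → Matrix mm mm ℂ) (k : Fin (d + 1) → ZMod (2 * L)) :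
    (ScX' d L mv kk r hL × ι → ℝ) →ₗ[ℝ] (ScX' d L mv kk r hL × ι → ℝ) :=
  scQQ' d L mv kk r hL a ι - mmulOp (fun x => coordMat e (ContinuousLinearMap.mulLeftRight ℝ (Matrix mm mm ℂ) (w k x) (w k x)ᴴ)) ∘ₗ scP' d L mv kk r hL a ι e U ∘ₗ
    mmulOp (fun x => (coordMat e (ContinuousLinearMap.mulLeftRight ℝ (Matrix mm mm ℂ) (w k x) (w k x)ᴴ))ᵀ)

end Objects

section Algebra

variable {L : ℕ} [NeZero L] {mv kk r : ℕ} {hL : Odd L ∧ 1 < L} (ι : Type) [Fintype ι] [DecidableEq ι] {mm : Type} [Fintype mm] [DecidableEq mm] (e : Matrix mm mm ℂ ≃L[ℝ] (ι → ℝ))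

/-- 52's [hP] for the summand, BY DEFINITION of `N_V k`. [folklore] -/
theorem scP'_conj (a : ℝ) (w : (Fin (d + 1) → ZMod (2 * L)) → ScX' d L mv kk r hL → Matrix mm mm ℂ) (U : Fin (d + 1) → ScX' d L mv kk r hL → Matrix mm mm ℂ) (k : Fin (d + 1) → ZMod (2 * L)) :
    mmulOp (fun x => coordMat e (ContinuousLinearMap.mulLeftRight ℝ (Matrix mm mm ℂ) (w k x) (w k x)ᴴ)) ∘ₗ scP' d L mv kk r hL a ι e U ∘ₗ
        mmulOp (fun x => (coordMat e (ContinuousLinearMap.mulLeftRight ℝ (Matrix mm mm ℂ) (w k x) (w k x)ᴴ))ᵀ) = scQQ' d L mv kk r hL a ι - scNV' d L mv kk r hL a ι e w U k := by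
  rw [scNV', sub_sub_cancel]

omit [NeZero L] in
/-- the transporters of the gauged field are n15-c∕198's `gaugeT W T` (`W = coordMat e Ad_w`, unitary `w`, trace-form coordinates). [cite: Balaban1985BackgroundPropagators, (3.28) p.395, (3.31) p.395] -/
theorem cvT_scGaugeU' (he : ∀ A B : Matrix mm mm ℂ, traceForm A B = e A ⬝ᵥ e B) {w : ScX' d L mv kk r hL → Matrix mm mm ℂ} (hw : ∀ x, (w x)ᴴ * w x = 1)
    (U : Fin (d + 1) → ScX' d L mv kk r hL → Matrix mm mm ℂ) :
    cvT e (scGaugeU' d L mv kk r hL w U) = gaugeT (cvM d L mv kk hL) (L ^ r * L ^ kk) (fun x => coordMat e (ContinuousLinearMap.mulLeftRight ℝ (Matrix mm mm ℂ) (w x) (w x)ᴴ)) (cvT e U) := by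
  have hT : ∀ x, (coordMat e (ContinuousLinearMap.mulLeftRight ℝ (Matrix mm mm ℂ) (w x) (w x)ᴴ))ᵀ = coordMat e (ContinuousLinearMap.mulLeftRight ℝ (Matrix mm mm ℂ) (w x)ᴴ (w x)) :=
    fun x => uN_siteGauge_transpose_eq e w he hw x
  funext ν x
  simp only [cvT, scGaugeU', gaugeT]
  rw [hT, coordMat_mulLeftRight_mul, coordMat_mulLeftRight_mul, Matrix.conjTranspose_mul, Matrix.conjTranspose_mul, Matrix.conjTranspose_conjTranspose]
  rfl

/-- ★ **(3.32) FOR THE AVERAGING SUMMAND**: `M_W∘(a·Q′_Tᵀ Q′_T)∘M_{Wᵀ} = a·Q′_{T^W}ᵀ Q′_{T^W}` (n15-c∕198 `csavg_gauge`: `Q′_{T^W} = 𝕎_c Q′_T 𝕎ᵀ`, `𝕎_cᵀ𝕎_c = 1`). [cite: Balaban1985BackgroundPropagators, (3.32)–(3.33) pp.395–396] -/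
theorem scP'_gauge (he : ∀ A B : Matrix mm mm ℂ, traceForm A B = e A ⬝ᵥ e B) (a : ℝ) {w : ScX' d L mv kk r hL → Matrix mm mm ℂ} (hw : ∀ x, (w x)ᴴ * w x = 1)
    (U : Fin (d + 1) → ScX' d L mv kk r hL → Matrix mm mm ℂ) :
    mmulOp (fun x => coordMat e (ContinuousLinearMap.mulLeftRight ℝ (Matrix mm mm ℂ) (w x) (w x)ᴴ)) ∘ₗ scP' d L mv kk r hL a ι e U ∘ₗ
        mmulOp (fun x => (coordMat e (ContinuousLinearMap.mulLeftRight ℝ (Matrix mm mm ℂ) (w x) (w x)ᴴ))ᵀ) = scP' d L mv kk r hL a ι e (scGaugeU' d L mv kk r hL w U) := by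
  have hW : ∀ x, (coordMat e (ContinuousLinearMap.mulLeftRight ℝ (Matrix mm mm ℂ) (w x) (w x)ᴴ))ᵀ * coordMat e (ContinuousLinearMap.mulLeftRight ℝ (Matrix mm mm ℂ) (w x) (w x)ᴴ) = 1 :=
    fun x => (uN_coordMat_conj_orthogonal e he (hw x)).1
  set B₀ : Matrix (Tor (cvM d L mv kk hL) × ι) (Tor (cvM d L mv kk hL) × ι) ℝ :=
    bdiag fun y : Tor (cvM d L mv kk hL) => coordMat e (ContinuousLinearMap.mulLeftRight ℝ (Matrix mm mm ℂ) (w (bpt ((L ^ r * L ^ kk)) (cvM d L mv kk hL) y 0)) (w (bpt ((L ^ r * L ^ kk)) (cvM d L mv kk hL) y 0))ᴴ) with hB₀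
  have h1 : B₀ᵀ * B₀ = 1 := bdiag_orth (fun y : Tor (cvM d L mv kk hL) => hW (bpt ((L ^ r * L ^ kk)) (cvM d L mv kk hL) y 0))
  rw [scP', scP', cvT_scGaugeU' ι e he hw U, csavg_gauge (cvM d L mv kk hL) (L ^ r * L ^ kk) hW, mmulOp_eq_mulVecLin_bdiag, mmulOp_eq_mulVecLin_bdiag, ← Matrix.mulVecLin_mul, ← Matrix.mulVecLin_mul,
    ← bdiag_transpose, ← hB₀]
  congr 1
  rw [Matrix.transpose_mul, Matrix.transpose_mul, Matrix.transpose_transpose, Matrix.smul_mul, Matrix.mul_smul]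
  congr 1
  simp only [Matrix.mul_assoc]
  rw [← Matrix.mul_assoc B₀ᵀ B₀, h1, Matrix.one_mul]

/-- ★ `N_V k = mulVecLin (a·(Q′₁ᵀQ′₁ − Q′_{T_k}ᵀQ′_{T_k}))`, `T_k = cvT e (U^{w_k})`. [cite: Balaban1985BackgroundPropagators, (3.59)–(3.60) p.402 (shape)] -/
theorem scNV'_eq (he : ∀ A B : Matrix mm mm ℂ, traceForm A B = e A ⬝ᵥ e B) (a : ℝ) {w : (Fin (d + 1) → ZMod (2 * L)) → ScX' d L mv kk r hL → Matrix mm mm ℂ} (hw : ∀ k x, (w k x)ᴴ * w k x = 1)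
    (U : Fin (d + 1) → ScX' d L mv kk r hL → Matrix mm mm ℂ) (k : Fin (d + 1) → ZMod (2 * L)) :
    scNV' d L mv kk r hL a ι e w U k = Matrix.mulVecLin (a • (((csavg (cvM d L mv kk hL) (L ^ r * L ^ kk) (fun (_ : Fin (d + 1)) (_ : ScX' d L mv kk r hL) => (1 : Matrix ι ι ℝ)))ᵀ *
        csavg (cvM d L mv kk hL) (L ^ r * L ^ kk) (fun (_ : Fin (d + 1)) (_ : ScX' d L mv kk r hL) => (1 : Matrix ι ι ℝ))) -
      ((csavg (cvM d L mv kk hL) (L ^ r * L ^ kk) (cvT e (scGaugeU' d L mv kk r hL (w k) U)))ᵀ * csavg (cvM d L mv kk hL) (L ^ r * L ^ kk) (cvT e (scGaugeU' d L mv kk r hL (w k) U))))) := by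
  rw [scNV', scP'_gauge ι e he a (hw k) U, scQQ', scP', ← mulVecLin_sub', smul_sub]

end Algebra

/-! ## §2 Block-diagonality: the far row vanishes -/

section Far

variable {L : ℕ} [NeZero L] {mv kk r : ℕ} {hL : Odd L ∧ 1 < L} (ι : Type) [Fintype ι] [DecidableEq ι]

/-- the entries of `a·(Q′₁ᵀQ′₁ − Q′_TᵀQ′_T)` vanish across blocks. [cite: Balaban1985BackgroundPropagators, (3.19) p.393 (the block average: shape)] -/
theorem csavgSq_sub_apply_of_ne' (a : ℝ) (T : Fin (d + 1) → ScX' d L mv kk r hL → Matrix ι ι ℝ) {p q : ScX' d L mv kk r hL × ι}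
    (h : blockOf (L ^ r * L ^ kk) (cvM d L mv kk hL) q.1 ≠ blockOf (L ^ r * L ^ kk) (cvM d L mv kk hL) p.1) :
    (a • (((csavg (cvM d L mv kk hL) (L ^ r * L ^ kk) (fun (_ : Fin (d + 1)) (_ : ScX' d L mv kk r hL) => (1 : Matrix ι ι ℝ)))ᵀ *
        csavg (cvM d L mv kk hL) (L ^ r * L ^ kk) (fun (_ : Fin (d + 1)) (_ : ScX' d L mv kk r hL) => (1 : Matrix ι ι ℝ))) -
      ((csavg (cvM d L mv kk hL) (L ^ r * L ^ kk) T)ᵀ * csavg (cvM d L mv kk hL) (L ^ r * L ^ kk) T))) p q = 0 := by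
  rw [Matrix.smul_apply, Matrix.sub_apply, csavg_transpose_mul_csavg_apply, csavg_transpose_mul_csavg_apply, if_neg h, if_neg h, sub_zero, smul_zero]

omit [DecidableEq ι] in
/-- a block-diagonal matrix between a source cut and the complement of a larger target plateau, both block-constant, gives zero. [folklore] -/
theorem one_sub_mulOp_comp_mulVecLin_comp_mulOp_eq_zero' (D : Matrix (ScX' d L mv kk r hL × ι) (ScX' d L mv kk r hL × ι) ℝ)
    (hD : ∀ p q, blockOf (L ^ r * L ^ kk) (cvM d L mv kk hL) q.1 ≠ blockOf (L ^ r * L ^ kk) (cvM d L mv kk hL) p.1 → D p q = 0) {ψ χ : ScX' d L mv kk r hL → ℝ}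
    (hψχ : ∀ x x', χ x' ≠ 0 → blockOf (L ^ r * L ^ kk) (cvM d L mv kk hL) x' = blockOf (L ^ r * L ^ kk) (cvM d L mv kk hL) x → ψ x = 1) :
    (LinearMap.id - mulOp (fun p : ScX' d L mv kk r hL × ι => ψ p.1)) ∘ₗ Matrix.mulVecLin D ∘ₗ mulOp (fun p : ScX' d L mv kk r hL × ι => χ p.1) = 0 := by
  classical
  refine LinearMap.ext fun f => funext fun p => ?_
  simp only [LinearMap.comp_apply, LinearMap.sub_apply, LinearMap.id_apply, Pi.sub_apply, mulOp_apply, LinearMap.zero_apply, Pi.zero_apply, Matrix.mulVecLin_apply]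
  by_cases hψ : ψ p.1 = 1
  · rw [hψ, one_mul, sub_self]
  · have hzero : (D *ᵥ (mulOp (fun p : ScX' d L mv kk r hL × ι => χ p.1) f)) p = 0 := by
      rw [Matrix.mulVec, dotProduct]
      refine Finset.sum_eq_zero fun q _ => ?_
      by_cases hb : blockOf (L ^ r * L ^ kk) (cvM d L mv kk hL) q.1 = blockOf (L ^ r * L ^ kk) (cvM d L mv kk hL) p.1
      · have hχ : χ q.1 = 0 := by
          by_contra hne
          exact hψ (hψχ p.1 q.1 hne hb)
        rw [mulOp_apply, hχ, zero_mul, mul_zero]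
      · rw [hD p q hb, zero_mul]
    rw [hzero, mul_zero, sub_self]

variable {mm : Type} [Fintype mm] [DecidableEq mm] (e : Matrix mm mm ℂ ≃L[ℝ] (ι → ℝ))

/-- ★★ **52's FAR ROW VANISHES FOR THE AVERAGING SUMMAND** [hfarN]: `(1 − M_{ψ_k})∘N_V k∘M_{χ_k} = 0` — `N_V k` is block-diagonal, the cut box lies in the cube, both are unions of
blocks. [cite: Balaban1985BackgroundPropagators, (3.59)–(3.60) p.402, p.410 (locality in U: shape)] -/
theorem one_sub_scPsi'_comp_scNV'_comp_scChi' (he : ∀ A B : Matrix mm mm ℂ, traceForm A B = e A ⬝ᵥ e B) (hM : ∀ ν, cvM d L mv kk hL ν = 2 * L * L ^ mv)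
    (hm₁ : 2 * L ^ mv ≤ coverMargin L mv) (hfitI : coverMargin L mv - 2 * L ^ mv + (6 * L ^ mv + 1) ≤ L * L ^ mv) (hS0 : L * L ^ mv ≤ 2 * L * L ^ mv) (a : ℝ)
    {w : (Fin (d + 1) → ZMod (2 * L)) → ScX' d L mv kk r hL → Matrix mm mm ℂ} (hw : ∀ k x, (w k x)ᴴ * w k x = 1) (U : Fin (d + 1) → ScX' d L mv kk r hL → Matrix mm mm ℂ)
    (k : Fin (d + 1) → ZMod (2 * L)) :
    (LinearMap.id - mulOp (fun p : ScX' d L mv kk r hL × ι => scPsi' d L mv kk r hL k p.1)) ∘ₗ scNV' d L mv kk r hL a ι e w U k ∘ₗ mulOp (fun p : ScX' d L mv kk r hL × ι => scChi' d L mv kk r hL k p.1) = 0 := by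
  rw [scNV'_eq ι e he a hw U k]
  refine one_sub_mulOp_comp_mulVecLin_comp_mulOp_eq_zero' ι _ (fun p q hpq => csavgSq_sub_apply_of_ne' ι a _ hpq) fun x x' hx' hb => ?_
  have h1 : scChi' d L mv kk r hL k x ≠ 0 := by
    have e1 : scChi' d L mv kk r hL k x = scChi' d L mv kk r hL k x' := by
      show chiCube _ _ _ _ (x, 0) = chiCube _ _ _ _ (x', 0)
      simp only [chiCube, hb]
    rw [e1]; exact hx'
  exact chiCube_eq_one_of_inner_ne_zero hM hm₁ hfitI hS0 h1

end Far

/-! ## §3 The box-local letter of the cut row -/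

section Letter

variable {L : ℕ} [NeZero L] {mv kk r : ℕ} {hL : Odd L ∧ 1 < L} (ι : Type) [Fintype ι] [DecidableEq ι]

/-- ★ **THE STAIRCASE OF BLOCK `y` READS BONDS OF BLOCK `y` ONLY**: rows of `T(Γ_{y,a}) − 1` are `≤ (1+ρ)^{(d+1)n} − 1` as soon as the rows of `T_μ(x) − 1` are `≤ ρ` at the sites `x` of
the block `y` (n15-c∕182 `rows_cvaStair_sub_one_le`, localised: every leg bond `bondAt y a μ ν t` has base point `bpt y (…)` in block `y`). [cite: Balaban1985Averaging, (125)–(126) p.36 (shape)] -/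
theorem rows_cvaStair_sub_one_le_of_blockOf' {T : Fin (d + 1) → ScX' d L mv kk r hL → Matrix ι ι ℝ} {ρ : ℝ} (hρ : 0 ≤ ρ) (y : Tor (cvM d L mv kk hL))
    (hT : ∀ μ x, blockOf (L ^ r * L ^ kk) (cvM d L mv kk hL) x = y → ∀ i, ∑ j, |(T μ x - 1) i j| ≤ ρ) (a : Fin (d + 1) → Fin (L ^ r * L ^ kk)) (ν : Fin (d + 1)) (i : ι) :
    ∑ j, |(cvaStair (cvM d L mv kk hL) (L ^ r * L ^ kk) (fun μ b => T μ b.1) y a ν - 1) i j| ≤ (1 + ρ) ^ ((d + 1) * (L ^ r * L ^ kk)) - 1 := by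
  have hρ₁ : 0 ≤ (1 + ρ) ^ ((L ^ r * L ^ kk)) - 1 := by have := one_le_pow₀ (M₀ := ℝ) (a := 1 + ρ) (by linarith) (n := (L ^ r * L ^ kk)); linarith
  have hleg : ∀ t < d + 1, ∀ i, ∑ j, |((if h : t < d + 1 then cvaLeg (cvM d L mv kk hL) (L ^ r * L ^ kk) (fun μ b => T μ b.1) y a ⟨t, h⟩ ν else 1) - 1) i j| ≤ (1 + ρ) ^ ((L ^ r * L ^ kk)) - 1 := by
    intro t ht i
    rw [dif_pos ht, cvaLeg]
    exact (rows_mprod_sub_one_le hρ (fun s _ i' => hT _ _ (kingBlockOf_bpt _ _ _ _) i') i).trans (T4AxialChain.pow_sub_one_mono hρ (a ⟨t, ht⟩).isLt.le)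
  refine (rows_mprod_sub_one_le hρ₁ hleg i).trans (le_of_eq ?_)
  rw [add_sub_cancel, ← pow_mul, mul_comm]

/-- ★★★ **THE BLOCK ROW OF `a·(Q′₁ᵀQ′₁ − Q′_TᵀQ′_T)` BEHIND A SOURCE CUT**: if on every block met by `supp χ` the staircase transports satisfy `|T(Γ) − 1| ≤ σ` entrywise, then
`mulVecLin (a·(Q′₁ᵀQ′₁ − Q′_TᵀQ′_T))∘M_χ ≤ |a|·n^{−(d+1)}·|ι|(|ι|σ² + 2σ)·e^{−ρ|y−y′|_T}` (block-diagonal; `n^{d+1}` sources per block against the weight `n^{−2(d+1)}`; any rate `ρ`).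
[cite: Balaban1985BackgroundPropagators, (3.19) p.393, (3.59)–(3.60) p.402, p.410 (locality: shape)] -/
theorem hasMaj_csavgSq_sub_cut' (a : ℝ) (T : Fin (d + 1) → ScX' d L mv kk r hL → Matrix ι ι ℝ) {σ : ℝ} (hσ0 : 0 ≤ σ) {S : Set (Tor (cvM d L mv kk hL))}
    (hσ : ∀ y ∈ S, ∀ aa i j, |(cvaStair (cvM d L mv kk hL) (L ^ r * L ^ kk) (fun μ b => T μ b.1) y aa 0 - 1) i j| ≤ σ)
    {χ : ScX' d L mv kk r hL → ℝ} (hχ1 : ∀ x, |χ x| ≤ 1) (hχS : ∀ x, χ x ≠ 0 → blockOf (L ^ r * L ^ kk) (cvM d L mv kk hL) x ∈ S) (ρ : ℝ) :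
    HasMaj (ScNorm' d L mv kk r hL ι) (ScNorm' d L mv kk r hL ι)
      (Matrix.mulVecLin (a • (((csavg (cvM d L mv kk hL) (L ^ r * L ^ kk) (fun (_ : Fin (d + 1)) (_ : ScX' d L mv kk r hL) => (1 : Matrix ι ι ℝ)))ᵀ *
          csavg (cvM d L mv kk hL) (L ^ r * L ^ kk) (fun (_ : Fin (d + 1)) (_ : ScX' d L mv kk r hL) => (1 : Matrix ι ι ℝ))) -
        ((csavg (cvM d L mv kk hL) (L ^ r * L ^ kk) T)ᵀ * csavg (cvM d L mv kk hL) (L ^ r * L ^ kk) T))) ∘ₗ mulOp (fun p : ScX' d L mv kk r hL × ι => χ p.1))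
      (fun y y' => |a| * ((((L ^ r * L ^ kk : ℕ) : ℝ)) ^ (d + 1))⁻¹ * (Fintype.card ι * (Fintype.card ι * σ ^ 2 + 2 * σ)) * Real.exp (-(ρ * (unitTorusGeo L kk (cvM d L mv kk hL)).dist y y'))) := by
  classical
  intro y' f hf y
  dsimp only
  have hnr : (0 : ℝ) < ((L ^ r * L ^ kk : ℕ) : ℝ) := by exact_mod_cast Nat.pos_of_ne_zero (NeZero.ne _)
  set c : ℝ := ((((L ^ r * L ^ kk : ℕ) : ℝ)) ^ (d + 1))⁻¹ with hc
  set Lσ : ℝ := Fintype.card ι * σ ^ 2 + 2 * σ with hLσ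
  have hc0 : 0 ≤ c := by positivity
  have hLσ0 : 0 ≤ Lσ := by positivity
  have hF0 := (ScNorm' d L mv kk r hL ι).loc_nonneg y' f
  -- the entries, with the source cut
  have hent : ∀ p q : ScX' d L mv kk r hL × ι, (a • (((csavg (cvM d L mv kk hL) (L ^ r * L ^ kk) (fun (_ : Fin (d + 1)) (_ : ScX' d L mv kk r hL) => (1 : Matrix ι ι ℝ)))ᵀ *
          csavg (cvM d L mv kk hL) (L ^ r * L ^ kk) (fun (_ : Fin (d + 1)) (_ : ScX' d L mv kk r hL) => (1 : Matrix ι ι ℝ))) -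
        ((csavg (cvM d L mv kk hL) (L ^ r * L ^ kk) T)ᵀ * csavg (cvM d L mv kk hL) (L ^ r * L ^ kk) T))) p q =
      if blockOf (L ^ r * L ^ kk) (cvM d L mv kk hL) q.1 = blockOf (L ^ r * L ^ kk) (cvM d L mv kk hL) p.1 then a * (c * c) *
        ∑ l, ((1 : Matrix ι ι ℝ) l p.2 * (1 : Matrix ι ι ℝ) l q.2 - cvaStair (cvM d L mv kk hL) (L ^ r * L ^ kk) (fun μ b => T μ b.1) (blockOf (L ^ r * L ^ kk) (cvM d L mv kk hL) p.1) (blockCoords ((L ^ r * L ^ kk)) (cvM d L mv kk hL) p.1).2 0 l p.2 *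
          cvaStair (cvM d L mv kk hL) (L ^ r * L ^ kk) (fun μ b => T μ b.1) (blockOf (L ^ r * L ^ kk) (cvM d L mv kk hL) p.1) (blockCoords ((L ^ r * L ^ kk)) (cvM d L mv kk hL) q.1).2 0 l q.2) else 0 := by
    intro p q
    rw [Matrix.smul_apply, Matrix.sub_apply, csavg_transpose_mul_csavg_apply, csavg_transpose_mul_csavg_apply]
    by_cases hb : blockOf (L ^ r * L ^ kk) (cvM d L mv kk hL) q.1 = blockOf (L ^ r * L ^ kk) (cvM d L mv kk hL) p.1
    · rw [if_pos hb, if_pos hb, if_pos hb]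
      simp only [cvaStair_one, smul_eq_mul, ← hc]
      rw [← mul_sub, ← Finset.sum_sub_distrib]; ring
    · simp only [if_neg hb, sub_zero, smul_zero]
  by_cases hy : y = y'
  · subst hy
    rw [tdistT_self, mul_zero, neg_zero, Real.exp_zero, mul_one]
    refine loc_ofBlocks_le (g := unitTorusGeo L kk (cvM d L mv kk hL)) (liftBlk (scBlk' d L mv kk r hL) ι) _ (by positivity) fun p hp => ?_
    rw [LinearMap.comp_apply, Matrix.mulVecLin_apply, Matrix.mulVec, dotProduct]
    by_cases hyS : y ∈ S
    · -- every source in the block of `p` contributes `≤ |a| c² Lσ · ‖f‖`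
      have hterm : ∀ q : ScX' d L mv kk r hL × ι, |(a • (((csavg (cvM d L mv kk hL) (L ^ r * L ^ kk) (fun (_ : Fin (d + 1)) (_ : ScX' d L mv kk r hL) => (1 : Matrix ι ι ℝ)))ᵀ *
            csavg (cvM d L mv kk hL) (L ^ r * L ^ kk) (fun (_ : Fin (d + 1)) (_ : ScX' d L mv kk r hL) => (1 : Matrix ι ι ℝ))) -
          ((csavg (cvM d L mv kk hL) (L ^ r * L ^ kk) T)ᵀ * csavg (cvM d L mv kk hL) (L ^ r * L ^ kk) T))) p q * mulOp (fun p : ScX' d L mv kk r hL × ι => χ p.1) f q| ≤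
          if blockOf (L ^ r * L ^ kk) (cvM d L mv kk hL) q.1 = blockOf (L ^ r * L ^ kk) (cvM d L mv kk hL) p.1 then |a| * (c * c) * Lσ * (ScNorm' d L mv kk r hL ι).loc y f else 0 := by
        intro q
        rw [hent p q]
        by_cases hb : blockOf (L ^ r * L ^ kk) (cvM d L mv kk hL) q.1 = blockOf (L ^ r * L ^ kk) (cvM d L mv kk hL) p.1
        · rw [if_pos hb, if_pos hb, abs_mul, abs_mul, abs_mul, abs_of_nonneg (mul_nonneg hc0 hc0), mulOp_apply, abs_mul]
          have hq : liftBlk (scBlk' d L mv kk r hL) ι q = y := hb.trans hp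
          have hp' : blockOf (L ^ r * L ^ kk) (cvM d L mv kk hL) p.1 = y := hp
          have hU := hσ y hyS
          refine mul_le_mul (mul_le_mul_of_nonneg_left ?_ (by positivity)) ?_ (by positivity) (by positivity)
          · rw [hp']; exact abs_sum_one_sub_mul_le ι hσ0 (fun i j => hU _ i j) (fun i j => hU _ i j) p.2 q.2
          · exact (mul_le_of_le_one_left (abs_nonneg _) (hχ1 q.1)).trans (abs_le_loc_ofBlocks (g := unitTorusGeo L kk (cvM d L mv kk hL)) (liftBlk (scBlk' d L mv kk r hL) ι) f hq)
        · rw [if_neg hb, if_neg hb, zero_mul, abs_zero]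
      calc |∑ q, (a • (((csavg (cvM d L mv kk hL) (L ^ r * L ^ kk) (fun (_ : Fin (d + 1)) (_ : ScX' d L mv kk r hL) => (1 : Matrix ι ι ℝ)))ᵀ *
              csavg (cvM d L mv kk hL) (L ^ r * L ^ kk) (fun (_ : Fin (d + 1)) (_ : ScX' d L mv kk r hL) => (1 : Matrix ι ι ℝ))) -
            ((csavg (cvM d L mv kk hL) (L ^ r * L ^ kk) T)ᵀ * csavg (cvM d L mv kk hL) (L ^ r * L ^ kk) T))) p q * mulOp (fun p : ScX' d L mv kk r hL × ι => χ p.1) f q|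
          ≤ ∑ q : ScX' d L mv kk r hL × ι, (if blockOf (L ^ r * L ^ kk) (cvM d L mv kk hL) q.1 = blockOf (L ^ r * L ^ kk) (cvM d L mv kk hL) p.1 then |a| * (c * c) * Lσ * (ScNorm' d L mv kk r hL ι).loc y f else 0) :=
            (Finset.abs_sum_le_sum_abs _ _).trans (Finset.sum_le_sum fun q _ => hterm q)
        _ = ((L ^ r * L ^ kk : ℕ) : ℝ) ^ (d + 1) * Fintype.card ι * (|a| * (c * c) * Lσ * (ScNorm' d L mv kk r hL ι).loc y f) := by
            rw [← Finset.sum_filter, Finset.sum_const, nsmul_eq_mul]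
            have hset : Finset.univ.filter (fun q : ScX' d L mv kk r hL × ι => blockOf (L ^ r * L ^ kk) (cvM d L mv kk hL) q.1 = blockOf (L ^ r * L ^ kk) (cvM d L mv kk hL) p.1) =
                T4EtaRateCoeffDefect.fibre (blockOf (L ^ r * L ^ kk) (cvM d L mv kk hL)) (blockOf (L ^ r * L ^ kk) (cvM d L mv kk hL) p.1) ×ˢ (Finset.univ : Finset ι) := by
              ext q
              simp only [Finset.mem_filter, Finset.mem_univ, true_and, Finset.mem_product, and_true, T4EtaRateCoeffDefect.fibre]
            rw [hset, Finset.card_product, Finset.card_univ, card_fibre_blockOf_fine]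
            push_cast; ring
        _ = |a| * c * (Fintype.card ι * Lσ) * (ScNorm' d L mv kk r hL ι).loc y f := by rw [hc]; field_simp
    · -- off the support of `χ`: every term vanishes
      have hzero : ∀ q : ScX' d L mv kk r hL × ι, (a • (((csavg (cvM d L mv kk hL) (L ^ r * L ^ kk) (fun (_ : Fin (d + 1)) (_ : ScX' d L mv kk r hL) => (1 : Matrix ι ι ℝ)))ᵀ *
            csavg (cvM d L mv kk hL) (L ^ r * L ^ kk) (fun (_ : Fin (d + 1)) (_ : ScX' d L mv kk r hL) => (1 : Matrix ι ι ℝ))) -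
          ((csavg (cvM d L mv kk hL) (L ^ r * L ^ kk) T)ᵀ * csavg (cvM d L mv kk hL) (L ^ r * L ^ kk) T))) p q * mulOp (fun p : ScX' d L mv kk r hL × ι => χ p.1) f q = 0 := by
        intro q
        by_cases hb : blockOf (L ^ r * L ^ kk) (cvM d L mv kk hL) q.1 = blockOf (L ^ r * L ^ kk) (cvM d L mv kk hL) p.1
        · have hχ : χ q.1 = 0 := by
            by_contra hne
            exact hyS ((hb.trans hp) ▸ hχS q.1 hne)
          rw [mulOp_apply, hχ, zero_mul, mul_zero]
        · rw [hent p q, if_neg hb, zero_mul]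
      rw [Finset.sum_congr rfl fun q _ => hzero q, Finset.sum_const_zero, abs_zero]
      positivity
  · -- off the diagonal the block-diagonal operator vanishes on the block of `y`
    refine (loc_ofBlocks_le (g := unitTorusGeo L kk (cvM d L mv kk hL)) (liftBlk (scBlk' d L mv kk r hL) ι) _ le_rfl fun p hp => ?_).trans (by positivity)
    rw [LinearMap.comp_apply, Matrix.mulVecLin_apply, Matrix.mulVec, dotProduct]
    have hzero : ∀ q : ScX' d L mv kk r hL × ι, (a • (((csavg (cvM d L mv kk hL) (L ^ r * L ^ kk) (fun (_ : Fin (d + 1)) (_ : ScX' d L mv kk r hL) => (1 : Matrix ι ι ℝ)))ᵀ *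
          csavg (cvM d L mv kk hL) (L ^ r * L ^ kk) (fun (_ : Fin (d + 1)) (_ : ScX' d L mv kk r hL) => (1 : Matrix ι ι ℝ))) -
        ((csavg (cvM d L mv kk hL) (L ^ r * L ^ kk) T)ᵀ * csavg (cvM d L mv kk hL) (L ^ r * L ^ kk) T))) p q * mulOp (fun p : ScX' d L mv kk r hL × ι => χ p.1) f q = 0 := by
      intro q
      by_cases hb : blockOf (L ^ r * L ^ kk) (cvM d L mv kk hL) q.1 = blockOf (L ^ r * L ^ kk) (cvM d L mv kk hL) p.1
      · rw [mulOp_apply, hf q (show liftBlk (scBlk' d L mv kk r hL) ι q ≠ y' from fun h => hy (hp.symm.trans (hb.symm.trans h))), mul_zero, mul_zero]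
      · rw [hent p q, if_neg hb, zero_mul]
    rw [Finset.sum_congr rfl fun q _ => hzero q, Finset.sum_const_zero, abs_zero]

variable {mm : Type} [Fintype mm] [DecidableEq mm] (e : Matrix mm mm ℂ ≃L[ℝ] (ι → ℝ))

/-- ★★★ **52's CUT ROW [hNVcut] FOR THE AVERAGING SUMMAND FROM THE (3.35) ROW LETTERS ON THE BOX ONLY**: if the forward coefficients of the gauged transporters satisfy
`Σ_j|a⁺_μ(x)_{ij}| ≤ r_V` at every site under the cut `χ_k` (52's `hAloc`, `inl`), then `M_{ψ_k}∘N_V k∘M_{χ_k} ≤ |a|·n^{−(d+1)}·|ι|(|ι|σ² + 2σ)·e^{−ρ|y−y′|_T}`,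
`σ = (1 + r_V n⁻¹)^{(d+1)n} − 1` (box-local: no smallness of `U` outside the box). [cite: Balaban1985BackgroundPropagators, (3.35) p.396, (3.59)–(3.60) p.402, Cor. 3.8 p.410 (locality in U: shape)] -/
theorem hasMaj_scNV'_cut_of_rows (he : ∀ A B : Matrix mm mm ℂ, traceForm A B = e A ⬝ᵥ e B) (a : ℝ)
    {w : (Fin (d + 1) → ZMod (2 * L)) → ScX' d L mv kk r hL → Matrix mm mm ℂ} (hw : ∀ k x, (w k x)ᴴ * w k x = 1) (U : Fin (d + 1) → ScX' d L mv kk r hL → Matrix mm mm ℂ)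
    {rV : ℝ} (hrV : 0 ≤ rV) (k : Fin (d + 1) → ZMod (2 * L))
    (hAloc : ∀ (μ : Fin (d + 1)) x, scChi' d L mv kk r hL k x ≠ 0 → ∀ i, ∑ j, |tCoefA ((((L ^ r * L ^ kk : ℕ) : ℝ))⁻¹) (gaugePair (scShift' d L mv kk r hL) fun μ x =>
      coordMat e (ContinuousLinearMap.mulLeftRight ℝ (Matrix mm mm ℂ) (w k x * U μ x * (w k (scShift' d L mv kk r hL μ x))ᴴ) (w k x * U μ x * (w k (scShift' d L mv kk r hL μ x))ᴴ)ᴴ)) (Sum.inl μ) x i j| ≤ rV) (ρ : ℝ) :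
    HasMaj (ScNorm' d L mv kk r hL ι) (ScNorm' d L mv kk r hL ι)
      (mulOp (fun p : ScX' d L mv kk r hL × ι => scPsi' d L mv kk r hL k p.1) ∘ₗ scNV' d L mv kk r hL a ι e w U k ∘ₗ mulOp (fun p : ScX' d L mv kk r hL × ι => scChi' d L mv kk r hL k p.1))
      (fun y y' => |a| * ((((L ^ r * L ^ kk : ℕ) : ℝ)) ^ (d + 1))⁻¹ * (Fintype.card ι * (Fintype.card ι * ((1 + rV * (((L ^ r * L ^ kk : ℕ) : ℝ))⁻¹) ^ ((d + 1) * (L ^ r * L ^ kk)) - 1) ^ 2 +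
        2 * ((1 + rV * (((L ^ r * L ^ kk : ℕ) : ℝ))⁻¹) ^ ((d + 1) * (L ^ r * L ^ kk)) - 1))) * Real.exp (-(ρ * (unitTorusGeo L kk (cvM d L mv kk hL)).dist y y'))) := by
  have hnr : (0 : ℝ) < ((L ^ r * L ^ kk : ℕ) : ℝ) := by exact_mod_cast Nat.pos_of_ne_zero (NeZero.ne _)
  have hρ0 : 0 ≤ rV * (((L ^ r * L ^ kk : ℕ) : ℝ))⁻¹ := by positivity
  have hσ0 : 0 ≤ (1 + rV * (((L ^ r * L ^ kk : ℕ) : ℝ))⁻¹) ^ ((d + 1) * (L ^ r * L ^ kk)) - 1 := by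
    have := one_le_pow₀ (M₀ := ℝ) (a := 1 + rV * (((L ^ r * L ^ kk : ℕ) : ℝ))⁻¹) (by linarith) (n := (d + 1) * (L ^ r * L ^ kk)); linarith
  -- the bond row letters of the gauged transporters at the sites under the cut
  have hT : ∀ μ x, scChi' d L mv kk r hL k x ≠ 0 → ∀ i, ∑ j, |(cvT e (scGaugeU' d L mv kk r hL (w k) U) μ x - 1) i j| ≤ rV * (((L ^ r * L ^ kk : ℕ) : ℝ))⁻¹ := by
    intro μ x hx i
    have h := hAloc μ x hx i
    simp only [tCoefA_inl, gaugePair_inl, Matrix.smul_apply, smul_eq_mul, abs_mul, inv_inv, abs_of_pos hnr, ← Finset.mul_sum] at h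
    rw [mul_comm, ← le_div_iff₀ hnr, div_eq_mul_inv] at h
    exact h
  -- the staircase entry letters on the box blocks
  have hstair : ∀ y ∈ ((cubeBlocks (cvM d L mv kk hL) (coverCorner (cvM d L mv kk hL) (L ^ mv) L (2 * L ^ mv) k) (6 * L ^ mv + 1) : Finset (Tor (cvM d L mv kk hL))) : Set (Tor (cvM d L mv kk hL))),
      ∀ aa i j, |(cvaStair (cvM d L mv kk hL) (L ^ r * L ^ kk) (fun μ b => cvT e (scGaugeU' d L mv kk r hL (w k) U) μ b.1) y aa 0 - 1) i j| ≤ (1 + rV * (((L ^ r * L ^ kk : ℕ) : ℝ))⁻¹) ^ ((d + 1) * (L ^ r * L ^ kk)) - 1 := by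
    intro y hy aa i j
    have hy' : y ∈ cubeBlocks (cvM d L mv kk hL) (coverCorner (cvM d L mv kk hL) (L ^ mv) L (2 * L ^ mv) k) (6 * L ^ mv + 1) := Finset.mem_coe.mp hy
    have hχ : ∀ x, blockOf (L ^ r * L ^ kk) (cvM d L mv kk hL) x = y → scChi' d L mv kk r hL k x ≠ 0 := by
      intro x hx
      show chiCube _ _ _ _ (x, 0) ≠ 0
      have e1 : chiCube (cvM d L mv kk hL) (L ^ r * L ^ kk) (coverCorner (cvM d L mv kk hL) (L ^ mv) L (2 * L ^ mv) k) (6 * L ^ mv + 1) (x, 0) = 1 := by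
        unfold chiCube
        rw [if_pos]
        show blockOf (L ^ r * L ^ kk) (cvM d L mv kk hL) x ∈ _
        rw [hx]; exact hy'
      rw [e1]; exact one_ne_zero
    have hrow := rows_cvaStair_sub_one_le_of_blockOf' ι hρ0 y (fun μ x hx i' => hT μ x (hχ x hx) i') aa 0 i
    exact (Finset.single_le_sum (fun j _ => abs_nonneg _) (Finset.mem_univ j)).trans hrow
  rw [scNV'_eq ι e he a hw U k]
  refine TwoGrid.hasMaj_mulOp_comp_of_abs_le_one (g := unitTorusGeo L kk (cvM d L mv kk hL)) (liftBlk (scBlk' d L mv kk r hL) ι) (fun p => abs_chiCube_le_one _ _) (fun y y' => by positivity) ?_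
  exact hasMaj_csavgSq_sub_cut' ι a (cvT e (scGaugeU' d L mv kk r hL (w k) U)) hσ0 (S := ((cubeBlocks (cvM d L mv kk hL) (coverCorner (cvM d L mv kk hL) (L ^ mv) L (2 * L ^ mv) k) (6 * L ^ mv + 1) : Finset (Tor (cvM d L mv kk hL))) : Set (Tor (cvM d L mv kk hL))))
    hstair (χ := scChi' d L mv kk r hL k) (fun x => abs_chiCube_le_one _ _) (fun x hx => Finset.mem_coe.mpr (by by_contra h; exact hx (chiCube_of_not_mem h))) ρ

end Letter

end Summit.QuantumFields.YangMills.BalabanUVNodes.N15.Gluing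

end
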